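import Summits.ValiantsHypothesis.ValiantsHypothesis.Theses.GrenetRigidity
import Literature.Computability.AlgebraicComplexity.AlperBogartVelascoProofs
import Literature.Computability.AlgebraicComplexity.RankOneDeterminantalExpressionsProofs

/-!
# Refutation of `GrenetRigidity.OptimalUniqueThree` (stmt-ValiantsHypothesis-3738) and of
# `GrenetRigidity.OptimalUnique` (stmt-ValiantsHypothesis-3735)

Route `ValiantsHypothesis/GrenetRigidity` posits that optimal affine determinantal representations of
`per_n` are unique up to `B = P·A(γ·x)·Q` or `B = P·A(γ·x)ᵀ·Q` with CONSTANT `P, Q ∈ GL_m(ℂ)` and `γ` in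
the realised symmetry group `permSymmetrySubst ℂ n` (`OptimalUnique`, crux; `OptimalUniqueThree`, its
instance `n = 3`, `m = 7`). Both are false, for a cheap structural reason: an affine representation
admits POLYNOMIAL unimodular column operations that keep all entries affine but are invisible to
constant `P, Q`.

Witness (rows/columns `s, u₀, u₁, u₂, v₀, v₁, v₂`; variables `X (r, c)`, `per₃ = ∑_σ ∏_c X (σ c, c)`):
`A` = Grenet's branching-program matrix of `per₃` (row `s` = `(0, X(0,0), X(1,0), X(2,0), 0,0,0)`,
identity on the `u`- and `v`-blocks, `A (u_j) (v_k) = X (3-j-k, 1)` for `j ≠ k`, column `s` =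
`X (k, 2)` in the `v`-rows), and `B = A · E` with `E = 1 + D`, `D` supported in the block `(u, v)`,
`D₀₀ = -X(1,0)`, `D₀₁ = -X(2,0)`, `D₁₀ = D₂₁ = X(0,0)` — the skew-symmetry `∑_j X(j,0) D_{jk} = 0` keeps
row `s` of `B` affine, and `det E = 1`, so `det A = det B = per₃` (`det A` is computed through the
unipotent factorisation `A · E₁ · E₂ = T`, `T` upper triangular with corner `per₃`). Invariant: the
coefficient matrix of the variable `X(0,0)` in `B` has an invertible `3 × 3` minor (rank `3`), whereas
every coefficient matrix of `A` has at most two non-zero rows; every `γ ∈ permSymmetrySubst ℂ 3` acts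
on the nine variables by a MONOMIAL matrix (Kronecker products of monomial matrices and the
transposition permutation), so the coefficient matrices of `P·A(γx)·Q` (or of its transpose variant)
are `P·(c • A_w)·Q`, of rank `≤ 2` — contradiction. With `dc(per₃) = 7` (Alper–Bogart–Velasco, PROVED
in the tree: `alperBogartVelasco2017_cor_1_4_holds`) the instance `n = 3` of `OptimalUnique` is
literally `OptimalUniqueThree`, whence the second refutation.

Moral for the planner: uniqueness (and, in `WindowStability`, decomposability) must be taken modulo
the affineness-preserving polynomial gauge `GL_m(ℂ[x]) × GL_m(ℂ[x])` (NOT modulo cokernel isomorphism,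
which is vacuous for unit-diagonal branching-program matrices: the cokernel is the cyclic module
`ℂ[x]/(per_n)`), not modulo constant `GL_m × GL_m`; as filed, `LaplaceBootstrap` and `DoublingGlue`
have a false antecedent. This agrees with the planner's suspect-false evidence on the item
(tangent gap `141` vs `96` at Grenet's point). All auxiliary facts are `have`s inside the first
theorem (refuter files carry negations only). Refuter route-review, 2026-08-15.
-/

noncomputable section

namespace Summit.ValiantsHypothesis.Theorems

open MvPolynomial Matrix
open scoped Kronecker
open Literature.Computability.AlgebraicComplexity
open Summit.ValiantsHypothesis.ValiantsHypothesis.Theses.GrenetRigidity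

-- one declaration inspecting all 49 entries of seven explicit `7 × 7` matrices at once: the default
-- per-declaration budget is exceeded although every single step is fast.
set_option maxHeartbeats 800000 in
/-- Refutes `GrenetRigidity.OptimalUniqueThree` (stmt-ValiantsHypothesis-3738): Grenet's `7 × 7`
representation `A` of `per₃` and its affine unimodular twist `B = A · (1 + D)` are both affine
determinantal representations of `perPoly (Fin 3) ℂ`, but no `(P, Q, γ)`, `γ ∈ permSymmetrySubst ℂ 3`,
maps `A` to `B` or to `B` transposed-form: the `X(0,0)`-coefficient matrix of `B` has rank `3`, those of
all `P·A(γx)·Q`, `P·A(γx)ᵀ·Q` rank `≤ 2`. [folklore] -/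
theorem GrenetRigidityOptimalUniqueThree_refuted : ¬ OptimalUniqueThree := by
  intro hOU
  -- ### the two representations `A`, `B` and the auxiliary unipotent / triangular matrices
  obtain ⟨gA, hgA⟩ : ∃ M : Matrix (Fin 7) (Fin 7) (MvPolynomial (Fin 3 × Fin 3) ℂ), M =
      !![0, X (0,0), X (1,0), X (2,0), 0, 0, 0;
         0, 1, 0, 0, 0, X (2,1), X (1,1);
         0, 0, 1, 0, X (2,1), 0, X (0,1);
         0, 0, 0, 1, X (1,1), X (0,1), 0;
         X (0,2), 0, 0, 0, 1, 0, 0;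
         X (1,2), 0, 0, 0, 0, 1, 0;
         X (2,2), 0, 0, 0, 0, 0, 1] := ⟨_, rfl⟩
  obtain ⟨gB, hgB⟩ : ∃ M : Matrix (Fin 7) (Fin 7) (MvPolynomial (Fin 3 × Fin 3) ℂ), M =
      !![0, X (0,0), X (1,0), X (2,0), 0, 0, 0;
         0, 1, 0, 0, -X (1,0), X (2,1) - X (2,0), X (1,1);
         0, 0, 1, 0, X (2,1) + X (0,0), 0, X (0,1);
         0, 0, 0, 1, X (1,1), X (0,1) + X (0,0), 0;
         X (0,2), 0, 0, 0, 1, 0, 0;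
         X (1,2), 0, 0, 0, 0, 1, 0;
         X (2,2), 0, 0, 0, 0, 0, 1] := ⟨_, rfl⟩
  obtain ⟨E1, hE1⟩ : ∃ M : Matrix (Fin 7) (Fin 7) (MvPolynomial (Fin 3 × Fin 3) ℂ), M =
      !![1, 0, 0, 0, 0, 0, 0;
         0, 1, 0, 0, 0, -X (2,1), -X (1,1);
         0, 0, 1, 0, -X (2,1), 0, -X (0,1);
         0, 0, 0, 1, -X (1,1), -X (0,1), 0;
         0, 0, 0, 0, 1, 0, 0;
         0, 0, 0, 0, 0, 1, 0;
         0, 0, 0, 0, 0, 0, 1] := ⟨_, rfl⟩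
  obtain ⟨E2, hE2⟩ : ∃ M : Matrix (Fin 7) (Fin 7) (MvPolynomial (Fin 3 × Fin 3) ℂ), M =
      !![1, 0, 0, 0, 0, 0, 0;
         0, 1, 0, 0, 0, 0, 0;
         0, 0, 1, 0, 0, 0, 0;
         0, 0, 0, 1, 0, 0, 0;
         -X (0,2), 0, 0, 0, 1, 0, 0;
         -X (1,2), 0, 0, 0, 0, 1, 0;
         -X (2,2), 0, 0, 0, 0, 0, 1] := ⟨_, rfl⟩
  obtain ⟨A1, hA1⟩ : ∃ M : Matrix (Fin 7) (Fin 7) (MvPolynomial (Fin 3 × Fin 3) ℂ), M =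
      !![0, X (0,0), X (1,0), X (2,0), -(X (1,0) * X (2,1) + X (2,0) * X (1,1)),
           -(X (0,0) * X (2,1) + X (2,0) * X (0,1)), -(X (0,0) * X (1,1) + X (1,0) * X (0,1));
         0, 1, 0, 0, 0, 0, 0;
         0, 0, 1, 0, 0, 0, 0;
         0, 0, 0, 1, 0, 0, 0;
         X (0,2), 0, 0, 0, 1, 0, 0;
         X (1,2), 0, 0, 0, 0, 1, 0;
         X (2,2), 0, 0, 0, 0, 0, 1] := ⟨_, rfl⟩
  obtain ⟨T, hT⟩ : ∃ M : Matrix (Fin 7) (Fin 7) (MvPolynomial (Fin 3 × Fin 3) ℂ), M =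
      !![perPoly (Fin 3) ℂ, X (0,0), X (1,0), X (2,0), -(X (1,0) * X (2,1) + X (2,0) * X (1,1)),
           -(X (0,0) * X (2,1) + X (2,0) * X (0,1)), -(X (0,0) * X (1,1) + X (1,0) * X (0,1));
         0, 1, 0, 0, 0, 0, 0;
         0, 0, 1, 0, 0, 0, 0;
         0, 0, 0, 1, 0, 0, 0;
         0, 0, 0, 0, 1, 0, 0;
         0, 0, 0, 0, 0, 1, 0;
         0, 0, 0, 0, 0, 0, 1] := ⟨_, rfl⟩
  obtain ⟨E, hE⟩ : ∃ M : Matrix (Fin 7) (Fin 7) (MvPolynomial (Fin 3 × Fin 3) ℂ), M =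
      !![1, 0, 0, 0, 0, 0, 0;
         0, 1, 0, 0, -X (1,0), -X (2,0), 0;
         0, 0, 1, 0, X (0,0), 0, 0;
         0, 0, 0, 1, 0, X (0,0), 0;
         0, 0, 0, 0, 1, 0, 0;
         0, 0, 0, 0, 0, 1, 0;
         0, 0, 0, 0, 0, 0, 1] := ⟨_, rfl⟩
  have p3 : perPoly (Fin 3) ℂ = X (0,0) * (X (1,1) * X (2,2) + X (2,1) * X (1,2))
      + X (1,0) * (X (0,1) * X (2,2) + X (2,1) * X (0,2))
      + X (2,0) * (X (0,1) * X (1,2) + X (1,1) * X (0,2)) := by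
    simp [perPoly, permanent_fin_three, Matrix.mvPolynomialX_apply]
  have deg_add : ∀ a b : Fin 3 × Fin 3, (X a + X b : MvPolynomial (Fin 3 × Fin 3) ℂ).totalDegree ≤ 1 :=
    fun a b => (totalDegree_add _ _).trans (by simp [totalDegree_X])
  have deg_sub : ∀ a b : Fin 3 × Fin 3, (X a - X b : MvPolynomial (Fin 3 × Fin 3) ℂ).totalDegree ≤ 1 :=
    fun a b => (totalDegree_sub _ _).trans (by simp [totalDegree_X])
  have coeff_one_single : ∀ v : Fin 3 × Fin 3,
      (1 : MvPolynomial (Fin 3 × Fin 3) ℂ).coeff (Finsupp.single v 1) = 0 := fun v => by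
    rw [MvPolynomial.coeff_one, if_neg]
    exact Ne.symm (Finsupp.single_ne_zero.mpr one_ne_zero)
  -- ### ONE inspection of the 49 entries: products, triangularity, degrees, shape of `A`, and the
  -- (at most two) rows `tP w`, `tQ w` in which the variable `X w` occurs in `A`
  have big : ∀ i j : Fin 7,
      ((gA * E1) i j = A1 i j ∧ (A1 * E2) i j = T i j ∧ (gA * E) i j = gB i j) ∧
      ((j < i → E1 i j = 0) ∧ (j < i → T i j = 0) ∧ (j < i → E i j = 0) ∧ (i < j → E2 i j = 0)) ∧
      ((gA i j).totalDegree ≤ 1 ∧ (gB i j).totalDegree ≤ 1) ∧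
      (gA i j = 0 ∨ gA i j = 1 ∨ ∃ w, gA i j = X w) ∧
      (∀ w : Fin 3 × Fin 3, (gA i j).coeff (Finsupp.single w 1) ≠ 0 →
        i = ![![(0 : Fin 7), 2, 4], ![0, 1, 5], ![0, 1, 6]] w.1 w.2 ∨
        i = ![![(1 : Fin 7), 3, 5], ![2, 3, 4], ![3, 2, 5]] w.1 w.2) := by
    intro i j
    rw [hgA, hgB, hE1, hE2, hA1, hT, hE, p3]
    fin_cases i <;> fin_cases j <;> refine ⟨⟨?_, ?_, ?_⟩, ⟨?_, ?_, ?_, ?_⟩, ⟨?_, ?_⟩, ?_, ?_⟩ <;>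
      simp [Matrix.mul_apply, Fin.sum_univ_seven, totalDegree_X, deg_add, deg_sub, totalDegree_neg,
        MvPolynomial.coeff_X, Finsupp.single_left_inj, coeff_one_single]
    all_goals ring
  -- ### determinants and the two affine determinantal representations of `per₃`
  have det_gA : gA.det = perPoly (Fin 3) ℂ := by
    have h1 : gA * E1 = A1 := Matrix.ext fun i j => (big i j).1.1
    have h2 : A1 * E2 = T := Matrix.ext fun i j => (big i j).1.2.1
    have dE1 : E1.det = 1 := by
      rw [Matrix.det_of_upperTriangular (M := E1) fun i j hij => (big i j).2.1.1 hij, Fin.prod_univ_seven,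
        hE1]
      simp
    have dE2 : E2.det = 1 := by
      rw [Matrix.det_of_lowerTriangular E2 (fun i j hij => (big i j).2.1.2.2.2 hij),
        Fin.prod_univ_seven, hE2]
      simp
    have dT : T.det = perPoly (Fin 3) ℂ := by
      rw [Matrix.det_of_upperTriangular (M := T) fun i j hij => (big i j).2.1.2.1 hij, Fin.prod_univ_seven,
        hT]
      simp
    have h := congrArg Matrix.det h2
    rwa [← h1, Matrix.det_mul, Matrix.det_mul, dE1, dE2, dT, mul_one, mul_one] at h
  have det_gB : gB.det = perPoly (Fin 3) ℂ := by
    have h1 : gA * E = gB := Matrix.ext fun i j => (big i j).1.2.2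
    have dE : E.det = 1 := by
      rw [Matrix.det_of_upperTriangular (M := E) fun i j hij => (big i j).2.1.2.2.1 hij,
        Fin.prod_univ_seven, hE]
      simp
    rw [← h1, Matrix.det_mul, det_gA, dE, mul_one]
  have gA_repr : IsAffineDetRepr (perPoly (Fin 3) ℂ) gA := ⟨fun i j => (big i j).2.2.1.1, det_gA⟩
  have gB_repr : IsAffineDetRepr (perPoly (Fin 3) ℂ) gB := ⟨fun i j => (big i j).2.2.1.2, det_gB⟩
  -- ### every realised symmetry of `per₃` is a monomial substitution of the variables
  have rm_mul : ∀ {ι : Type} [Fintype ι] [DecidableEq ι] {M N : Matrix ι ι ℂ},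
      (∀ i, ∃ (j : ι) (c : ℂ), ∀ j', M i j' = if j' = j then c else 0) →
      (∀ i, ∃ (j : ι) (c : ℂ), ∀ j', N i j' = if j' = j then c else 0) →
      ∀ i, ∃ (j : ι) (c : ℂ), ∀ j', (M * N) i j' = if j' = j then c else 0 := by
    intro ι _ _ M N hM hN i
    obtain ⟨j, c, hj⟩ := hM i
    obtain ⟨l, d, hl⟩ := hN j
    refine ⟨l, c * d, fun j' => ?_⟩
    simp only [Matrix.mul_apply, hj, ite_mul, zero_mul, Finset.sum_ite_eq', Finset.mem_univ, if_true,
      hl, mul_ite, mul_zero]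
  have rm_diag : ∀ {ι : Type} [DecidableEq ι] (d : ι → ℂ),
      ∀ i, ∃ (j : ι) (c : ℂ), ∀ j', Matrix.diagonal d i j' = if j' = j then c else 0 := by
    intro ι _ d i
    refine ⟨i, d i, fun j' => ?_⟩
    by_cases h : j' = i
    · subst h; simp
    · simp [h, Matrix.diagonal_apply_ne _ (Ne.symm h)]
  have rm_perm : ∀ {ι : Type} [DecidableEq ι] (π : Equiv.Perm ι),
      ∀ i, ∃ (j : ι) (c : ℂ), ∀ j', π.permMatrix ℂ i j' = if j' = j then c else 0 := fun π i =>
    ⟨π i, 1, fun j' => by simp [Equiv.Perm.permMatrix, PEquiv.toMatrix_apply, Equiv.toPEquiv_apply, eq_comm]⟩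
  have inv_perm : ∀ {ι : Type} [Fintype ι] [DecidableEq ι] (π : Equiv.Perm ι),
      (π.permMatrix ℂ)⁻¹ = π⁻¹.permMatrix ℂ := by
    intro ι _ _ π
    apply Matrix.inv_eq_right_inv
    rw [← Matrix.permMatrix_mul, inv_mul_cancel, Matrix.permMatrix_one]
  have rm_kron : ∀ {ι κ : Type} [DecidableEq ι] [DecidableEq κ] {M : Matrix ι ι ℂ},
      (∀ i, ∃ (j : ι) (c : ℂ), ∀ j', M i j' = if j' = j then c else 0) →
      (∀ i, ∃ (j : ι × κ) (c : ℂ), ∀ j', (M ⊗ₖ (1 : Matrix κ κ ℂ)) i j' = if j' = j then c else 0) ∧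
      (∀ i, ∃ (j : κ × ι) (c : ℂ), ∀ j', ((1 : Matrix κ κ ℂ) ⊗ₖ M) i j' = if j' = j then c else 0) := by
    intro ι κ _ _ M hM
    constructor
    · rintro ⟨i, k⟩
      obtain ⟨j, c, hj⟩ := hM i
      refine ⟨(j, k), c, ?_⟩
      rintro ⟨j', k'⟩
      simp only [Matrix.kronecker_apply, hj, Matrix.one_apply, Prod.mk.injEq]
      by_cases h1 : j' = j <;> by_cases h2 : k = k' <;> simp [h1, h2, eq_comm]
    · rintro ⟨k, i⟩
      obtain ⟨j, c, hj⟩ := hM i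
      refine ⟨(k, j), c, ?_⟩
      rintro ⟨k', j'⟩
      simp only [Matrix.kronecker_apply, hj, Matrix.one_apply, Prod.mk.injEq]
      by_cases h1 : j' = j <;> by_cases h2 : k = k' <;> simp [h1, h2, eq_comm]
  have rm_mono : ∀ {m : ℕ} {g : GL (Fin m) ℂ}, g ∈ monomialSubgroup ℂ m →
      ∀ i, ∃ (j : Fin m) (c : ℂ), ∀ j', (g : Matrix (Fin m) (Fin m) ℂ) i j' = if j' = j then c else 0 := by
    intro m g hg
    induction hg using Subgroup.closure_induction'' with
    | mem x hx =>
      rcases hx with ⟨π, hπ⟩ | ⟨d, hd⟩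
      · rw [hπ]; exact rm_perm π
      · rw [hd]; exact rm_diag d
    | inv_mem x hx =>
      rcases hx with ⟨π, hπ⟩ | ⟨d, hd⟩
      · rw [Matrix.coe_units_inv, hπ, inv_perm]; exact rm_perm _
      · rw [Matrix.coe_units_inv, hd, Matrix.inv_diagonal]; exact rm_diag _
    | one => simpa using rm_diag (fun _ : Fin m => (1 : ℂ))
    | mul x y _ _ hx hy => rw [Units.val_mul]; exact rm_mul hx hy
  have rm_symm : ∀ {γ : GL (Fin 3 × Fin 3) ℂ}, γ ∈ permSymmetrySubst ℂ 3 →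
      ∀ i, ∃ (j : Fin 3 × Fin 3) (c : ℂ), ∀ j',
        (γ : Matrix (Fin 3 × Fin 3) (Fin 3 × Fin 3) ℂ) i j' = if j' = j then c else 0 := by
    have hleft : ∀ {γ : GL (Fin 3 × Fin 3) ℂ}, γ ∈ leftMonomialSubst ℂ 3 →
        ∀ i, ∃ (j : Fin 3 × Fin 3) (c : ℂ), ∀ j',
          (γ : Matrix (Fin 3 × Fin 3) (Fin 3 × Fin 3) ℂ) i j' = if j' = j then c else 0 := by
      intro γ hγ
      induction hγ using Subgroup.closure_induction'' with
      | mem x hx =>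
        obtain ⟨g, hg, hx⟩ := hx
        rw [hx]; exact (rm_kron (rm_mono hg)).1
      | inv_mem x hx =>
        obtain ⟨g, hg, hx⟩ := hx
        rw [Matrix.coe_units_inv, hx, Matrix.inv_kronecker, inv_one, ← Matrix.coe_units_inv]
        exact (rm_kron (rm_mono (Subgroup.inv_mem _ hg))).1
      | one => simpa using rm_diag (fun _ : Fin 3 × Fin 3 => (1 : ℂ))
      | mul x y _ _ hx hy => rw [Units.val_mul]; exact rm_mul hx hy
    have hright : ∀ {γ : GL (Fin 3 × Fin 3) ℂ}, γ ∈ rightMonomialSubst ℂ 3 →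
        ∀ i, ∃ (j : Fin 3 × Fin 3) (c : ℂ), ∀ j',
          (γ : Matrix (Fin 3 × Fin 3) (Fin 3 × Fin 3) ℂ) i j' = if j' = j then c else 0 := by
      intro γ hγ
      induction hγ using Subgroup.closure_induction'' with
      | mem x hx =>
        obtain ⟨g, hg, hx⟩ := hx
        rw [hx]; exact (rm_kron (rm_mono hg)).2
      | inv_mem x hx =>
        obtain ⟨g, hg, hx⟩ := hx
        rw [Matrix.coe_units_inv, hx, Matrix.inv_kronecker, inv_one, ← Matrix.coe_units_inv]
        exact (rm_kron (rm_mono (Subgroup.inv_mem _ hg))).2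
      | one => simpa using rm_diag (fun _ : Fin 3 × Fin 3 => (1 : ℂ))
      | mul x y _ _ hx hy => rw [Units.val_mul]; exact rm_mul hx hy
    intro γ hγ
    induction hγ using Subgroup.closure_induction'' with
    | mem x hx =>
      rcases hx with (hx | hx) | hx
      · exact hleft hx
      · exact hright hx
      · have hx' : (x : Matrix (Fin 3 × Fin 3) (Fin 3 × Fin 3) ℂ) =
            Equiv.Perm.permMatrix ℂ (Equiv.prodComm (Fin 3) (Fin 3)) := hx
        rw [hx']; exact rm_perm _
    | inv_mem x hx =>
      rcases hx with (hx | hx) | hx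
      · exact hleft (Subgroup.inv_mem _ hx)
      · exact hright (Subgroup.inv_mem _ hx)
      · have hx' : (x : Matrix (Fin 3 × Fin 3) (Fin 3 × Fin 3) ℂ) =
            Equiv.Perm.permMatrix ℂ (Equiv.prodComm (Fin 3) (Fin 3)) := hx
        rw [Matrix.coe_units_inv, hx', inv_perm]; exact rm_perm _
    | one => simpa using rm_diag (fun _ : Fin 3 × Fin 3 => (1 : ℂ))
    | mul x y _ _ hx hy => rw [Units.val_mul]; exact rm_mul hx hy
  -- ### linear parts (coefficient matrices of the variables)
  obtain ⟨lin, hlin⟩ : ∃ f : Fin 3 × Fin 3 → Matrix (Fin 7) (Fin 7) (MvPolynomial (Fin 3 × Fin 3) ℂ) →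
      Matrix (Fin 7) (Fin 7) ℂ, ∀ v M, f v M = Matrix.of fun i j => (M i j).coeff (Finsupp.single v 1) :=
    ⟨_, fun _ _ => rfl⟩
  have lin_C_mul : ∀ v (P : Matrix (Fin 7) (Fin 7) ℂ) M, lin v (P.map C * M) = P * lin v M := by
    intro v P M
    apply Matrix.ext; intro i j
    simp [hlin, Matrix.mul_apply, MvPolynomial.coeff_sum, MvPolynomial.coeff_C_mul]
  have lin_mul_C : ∀ v M (Q : Matrix (Fin 7) (Fin 7) ℂ), lin v (M * Q.map C) = lin v M * Q := by
    intro v M Q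
    apply Matrix.ext; intro i j
    have hc : ∀ (p : MvPolynomial (Fin 3 × Fin 3) ℂ) (a : ℂ),
        (p * C a).coeff (Finsupp.single v 1) = p.coeff (Finsupp.single v 1) * a := fun p a => by
      rw [mul_comm, MvPolynomial.coeff_C_mul, mul_comm]
    simp [hlin, Matrix.mul_apply, MvPolynomial.coeff_sum, hc]
  have lin_transpose : ∀ v M, lin v Mᵀ = (lin v M)ᵀ := fun v M => by
    apply Matrix.ext; intro i j; simp [hlin]
  -- a linear substitution `Γ` acts on the linear parts of `A` through the rows of `Γ`
  have lin_subst : ∀ (Γ : Matrix (Fin 3 × Fin 3) (Fin 3 × Fin 3) ℂ) (v : Fin 3 × Fin 3),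
      lin v (gA.map (linSubst (Fin 3 × Fin 3) ℂ Γ)) = ∑ w, Γ v w • lin w gA := by
    intro Γ v
    apply Matrix.ext; intro i j
    simp only [hlin, Matrix.map_apply, Matrix.of_apply, Matrix.sum_apply, Matrix.smul_apply, smul_eq_mul]
    rcases (big i j).2.2.2.1 with h | h | ⟨w, h⟩ <;> rw [h]
    · simp
    · simp [coeff_one_single]
    · simp [linSubst, MvPolynomial.coeff_sum, MvPolynomial.coeff_X, Finsupp.single_left_inj]
  -- ### rank at most two: factoring through `ℂ²`
  have rk_map : ∀ {N : Matrix (Fin 7) (Fin 7) ℂ} (P Q : Matrix (Fin 7) (Fin 7) ℂ) (c : ℂ),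
      (∃ (U : Matrix (Fin 7) (Fin 2) ℂ) (V : Matrix (Fin 2) (Fin 7) ℂ), N = U * V) →
      (∃ (U : Matrix (Fin 7) (Fin 2) ℂ) (V : Matrix (Fin 2) (Fin 7) ℂ), P * (c • N) * Q = U * V) ∧
      (∃ (U : Matrix (Fin 7) (Fin 2) ℂ) (V : Matrix (Fin 2) (Fin 7) ℂ), P * (c • N)ᵀ * Q = U * V) := by
    rintro N P Q c ⟨U, V, rfl⟩
    refine ⟨⟨P * (c • U), V * Q, ?_⟩, ⟨P * Vᵀ, (c • U)ᵀ * Q, ?_⟩⟩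
    · rw [← Matrix.smul_mul, Matrix.mul_assoc, Matrix.mul_assoc, Matrix.mul_assoc]
    · rw [← Matrix.smul_mul, Matrix.transpose_mul, Matrix.mul_assoc, Matrix.mul_assoc, Matrix.mul_assoc]
  have rk_rows : ∀ {N : Matrix (Fin 7) (Fin 7) ℂ} (p q : Fin 7), p ≠ q →
      (∀ i, i ≠ p → i ≠ q → ∀ j, N i j = 0) →
      ∃ (U : Matrix (Fin 7) (Fin 2) ℂ) (V : Matrix (Fin 2) (Fin 7) ℂ), N = U * V := by
    intro N p q hpq h
    refine ⟨Matrix.of fun i a => if a = 0 then (if i = p then 1 else 0) else (if i = q then 1 else 0),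
      Matrix.of fun a j => if a = 0 then N p j else N q j, ?_⟩
    apply Matrix.ext; intro i j
    simp only [Matrix.mul_apply, Fin.sum_univ_two, Matrix.of_apply, Fin.isValue, if_true, one_ne_zero,
      if_false]
    by_cases hip : i = p
    · subst hip; simp [hpq]
    · by_cases hiq : i = q
      · subst hiq; simp [hip]
      · simp [hip, hiq, h i hip hiq j]
  -- every linear part of Grenet's matrix has at most two non-zero rows
  have rk_gA : ∀ w, ∃ (U : Matrix (Fin 7) (Fin 2) ℂ) (V : Matrix (Fin 2) (Fin 7) ℂ), lin w gA = U * V := by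
    intro w
    refine rk_rows (![![(0 : Fin 7), 2, 4], ![0, 1, 5], ![0, 1, 6]] w.1 w.2)
      (![![(1 : Fin 7), 3, 5], ![2, 3, 4], ![3, 2, 5]] w.1 w.2) ?_ fun i hp hq j => ?_
    · revert w; decide
    · rw [hlin, Matrix.of_apply]
      by_contra h
      rcases (big i j).2.2.2.2 w h with h' | h'
      exacts [hp h', hq h']
  -- the `X(0,0)`-linear part of the twist has an invertible `3 × 3` minor, hence rank three
  have rk_gB : ¬ ∃ (U : Matrix (Fin 7) (Fin 2) ℂ) (V : Matrix (Fin 2) (Fin 7) ℂ), lin (0,0) gB = U * V := by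
    rintro ⟨U, V, hUV⟩
    have h1 : ((lin (0,0) gB).submatrix ![0, 2, 3] ![1, 4, 5]).det = 1 := by
      rw [hlin, hgB]; simp [Matrix.det_fin_three, MvPolynomial.coeff_X, Finsupp.single_left_inj]
    have h2 : ((U * V).submatrix ![(0 : Fin 7), 2, 3] ![(1 : Fin 7), 4, 5]).det = 0 := by
      simp [Matrix.det_fin_three, Matrix.mul_apply, Fin.sum_univ_two]; ring
    rw [hUV, h2] at h1
    exact zero_ne_one h1
  -- ### conclusion
  obtain ⟨P, Q, γ, hγ, hPQ⟩ := hOU gA gB gA_repr gB_repr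
  obtain ⟨w, c, hrow⟩ := rm_symm hγ (0,0)
  have key : lin (0,0) (Matrix.linSubstEntries γ gA) = c • lin w gA := by
    rw [Matrix.linSubstEntries, lin_subst]
    simp only [hrow, ite_smul, zero_smul, Finset.sum_ite_eq', Finset.mem_univ, if_true]
  apply rk_gB
  rcases hPQ with hB | hB
  · rw [hB, lin_mul_C, lin_C_mul, key]
    exact (rk_map _ _ c (rk_gA w)).1
  · rw [hB, lin_mul_C, lin_C_mul, lin_transpose, key]
    exact (rk_map _ _ c (rk_gA w)).2

/-- Refutes `GrenetRigidity.OptimalUnique` (stmt-ValiantsHypothesis-3735): at `n = 3` the optimal size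
`determinantalComplexity (perPoly (Fin 3) ℂ)` is `7` (Alper–Bogart–Velasco 2017, Cor. 1.4, proved in the
tree), so the instance `n = 3` of `OptimalUnique` is `OptimalUniqueThree`, refuted above by Grenet's
matrix and its affine unimodular twist. [folklore] -/
theorem GrenetRigidityOptimalUnique_refuted : ¬ OptimalUnique := by
  intro h
  have h7 : determinantalComplexity (perPoly (Fin 3) ℂ) = 7 :=
    (alperBogartVelasco2017_cor_1_4_complex alperBogartVelasco2017_cor_1_4_holds).1
  have h3 := h 3 le_rfl
  revert h3
  rw [h7]
  exact GrenetRigidityOptimalUniqueThree_refuted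

end Summit.ValiantsHypothesis.Theorems

end
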